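import Literature.AlgebraicGeometry.HodgeTheory.WeilFamilyInvariantForms
import HarnessLib

/-!
# Weil's family of abelian varieties of Weil type, II: no stable real subspaces, scalar commutant

Companion to `WeilFamilyInvariantForms`. There, on `U = P × P` (`P` a complex inner product space of
dimension `n`, `U = ℂⁿ ⊕ ℂⁿ = V_ℝ` with van Geemen's Hermitian form `H` of signature `(n, n)`,
LNM 1594 (1994) §5.3–5.6), the tangent space of the `n²`-dimensional family of complex structures of
Weil type at its base point is the real subspace `𝔭 = {T_B = offDiag B : B ∈ End_ℂ P}`,
`T_B (x₁, x₂) = (B† x₂, B x₁)`, of `𝔲(H) ≅ 𝔲(n, n)`; it is the real span of the rank-one directions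
`T_{|w⟩⟨v|} (x₁, x₂) = (⟪w, x₂⟫ v, ⟪v, x₁⟫ w)` (`offDiag (rankOne w v)`).

B. van Geemen, *An introduction to the Hodge conjecture for abelian varieties*, LNM 1594, Thm. 6.11:
the special Mumford–Tate group of a GENERAL polarized abelian variety of Weil type `(X, K, E)` is
`SU_H`; with Lemma 6.10 (`V ⊗ ℂ = W ⊕ W^*`, `W` and `W^*` irreducible and, for `2n ≥ 3`,
non-isomorphic `SL(W)`-representations) this gives `End⁰(X) = End(V_ℚ)^{SU_H} = K`, so the general
member is SIMPLE and has no endomorphisms beyond `K`. This file records the INFINITESIMAL form of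
both consequences at a single point of the family, as elementary linear algebra, for `n ≥ 2`:

* `addSubgroup_eq_bot_or_eq_top_of_forall_rankOne` / `…_of_forall_offDiag` /
  `submodule_eq_bot_or_eq_top_of_forall_offDiag`: an additive subgroup (in particular a real
  subspace) of `U` stable under every tangent direction `T_B ∈ 𝔭` is `0` or `U` — no sub-torus
  (no sub-Hodge structure of `H₁`) persists to first order along the whole family;
* `exists_eq_smul_of_forall_rankOne`: an additive endomorphism of `U` commuting with every `T_B ∈ 𝔭` is
  multiplication by a complex scalar — `End ⊗ ℝ = K ⊗ ℝ = ℂ` to first order;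
* `exists_stable_addSubgroup_rank_one`: for `n = 1` both fail (`P = ℂ`: the real plane
  `{(z, conj z)}` is stable) — the family of abelian surfaces `E × E` carries the sub-curves `E × 0`
  along all of it; this is why `n ≥ 2` (`2n ≥ 3` in 6.10) is needed.

The proofs test the hypothesis on rank-one operators only: `T_{|w⟩⟨v|}` with `v ⊥ x₁` kills the
second component, and compositions `T_{|w⟩⟨v|} ∘ T_{|w⟩⟨v'|}` with `v ⊥ v'` are the block operators
`x ↦ ‖w‖² (⟪v', x₁⟫ v, 0)`; a vector orthogonal to a given one exists because `n ≥ 2`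
(`exists_ne_zero_inner_eq_zero`).

HONEST FRAMING. Lean index of the computation cell `pub-hsemireg`, widening seat `w1-tw-1` (W1): the
file is ELEMENTARY LINEAR ALGEBRA on `ℂⁿ ⊕ ℂⁿ` in the vocabulary of the Literature file
`WeilFamilyInvariantForms` (`offDiag`, `rankOne`); it is used by the seat's note
`run/shared/lean/pub/pub-hsemireg/widen/W1/CLEAN-FLAT-THEOREM-w1tw1.md`, step (S5′): a translate of a
non-zero proper abelian subvariety of a member `A₀` of an `(n, n)` Weil-type family with `n ≥ 2` never
deforms to first order along all `n²` Weil directions, at ANY point `A₀` (CM or not) — the dictionary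
`H₁(A₀, ℝ) = U`, `T_{A₀}(Weil family) = 𝔭` is van Geemen §5.3–5.6 and is NOT constructed here. No
abelian variety, Hodge class or semiregularity map appears in this file; nothing here says that HC,
HC_CM or HC_AV holds, and nothing here is a new case of anything.

## References

* B. van Geemen, in LNM 1594 (1994), §5.3–5.6, Lemma 6.10, Thm. 6.11. [vanGeemen1994HodgeAV]
-/

noncomputable section

open Complex Module
open scoped InnerProductSpace ComplexConjugate

namespace Summit.Ventures.HSemireg

namespace WeilFamily

open Literature.AlgebraicGeometry.HodgeTheory.WeilFamily

variable {P : Type*} [NormedAddCommGroup P] [InnerProductSpace ℂ P] [FiniteDimensional ℂ P]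

/-! ### Rank-one tangent directions -/

/-- The rank-one tangent direction: `T_{|w⟩⟨v|} (x₁, x₂) = (⟪w, x₂⟫ v, ⟪v, x₁⟫ w)`. [folklore] -/
theorem offDiag_rankOne_apply (w v : P) (x : P × P) :
    offDiag (rankOne w v) x = (⟪w, x.2⟫_ℂ • v, ⟪v, x.1⟫_ℂ • w) := by
  rw [offDiag, adjoint_rankOne_apply, rankOne_apply]

/-- `T_{|w⟩⟨v|} (x₁, 0) = (0, ⟪v, x₁⟫ w)`. [folklore] -/
theorem offDiag_rankOne_inl (w v x₁ : P) :
    offDiag (rankOne w v) (x₁, 0) = (0, ⟪v, x₁⟫_ℂ • w) := by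
  rw [offDiag_rankOne_apply, inner_zero_right, zero_smul]

/-- `T_{|w⟩⟨v|} (0, x₂) = (⟪w, x₂⟫ v, 0)`. [folklore] -/
theorem offDiag_rankOne_inr (w v x₂ : P) :
    offDiag (rankOne w v) (0, x₂) = (⟪w, x₂⟫_ℂ • v, 0) := by
  rw [offDiag_rankOne_apply, inner_zero_right, zero_smul]

omit [FiniteDimensional ℂ P] in
/-- `⟪v, v⟫ = ‖v‖²` as a complex number. [folklore] -/
theorem inner_self_eq_coe_norm_sq (v : P) : ⟪v, v⟫_ℂ = ((‖v‖ ^ 2 : ℝ) : ℂ) := by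
  rw [inner_self_eq_norm_sq_to_K]; norm_cast

omit [FiniteDimensional ℂ P] in
/-- Rescaling: for `u ≠ 0`, `⟪u, u⟫ • (‖u‖²)⁻¹ • y = y`. [folklore] -/
theorem inner_self_smul_inv_norm_sq_smul {u : P} (hu : u ≠ 0) (y : P) :
    ⟪u, u⟫_ℂ • (((‖u‖ ^ 2)⁻¹ : ℝ) : ℂ) • y = y := by
  have h : (‖u‖ ^ 2 : ℝ) ≠ 0 := pow_ne_zero 2 (norm_ne_zero_iff.2 hu)
  rw [inner_self_eq_coe_norm_sq, smul_smul, ← Complex.ofReal_mul, mul_inv_cancel₀ h,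
    Complex.ofReal_one, one_smul]

/-! ### No stable additive subgroups (general member simple, infinitesimal form) -/

/-- Key step: an additive subgroup of `U = P × P` stable under the rank-one tangent directions and
containing a vector `(u, 0)` with `u ≠ 0` is everything. [folklore] -/
theorem addSubgroup_eq_top_of_inl_mem (W : AddSubgroup (P × P))
    (hW : ∀ w v : P, ∀ x ∈ W, offDiag (rankOne w v) x ∈ W) {u : P} (hu : u ≠ 0)
    (huW : ((u, (0 : P)) : P × P) ∈ W) : W = ⊤ := by
  -- every `(0, y₂)` lies in `W`
  have h2 : ∀ y₂ : P, (((0 : P), y₂) : P × P) ∈ W := by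
    intro y₂
    have h := hW ((((‖u‖ ^ 2)⁻¹ : ℝ) : ℂ) • y₂) u _ huW
    rwa [offDiag_rankOne_inl, inner_self_smul_inv_norm_sq_smul hu] at h
  -- every `(y₁, 0)` lies in `W`
  have h1 : ∀ y₁ : P, ((y₁, (0 : P)) : P × P) ∈ W := by
    intro y₁
    have h := hW u ((((‖u‖ ^ 2)⁻¹ : ℝ) : ℂ) • y₁) _ (h2 u)
    rwa [offDiag_rankOne_inr, inner_self_smul_inv_norm_sq_smul hu] at h
  rw [eq_top_iff]
  rintro ⟨y₁, y₂⟩ -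
  have h := W.add_mem (h1 y₁) (h2 y₂)
  simpa using h

/-- **No sub-torus persists along the Weil family (`n ≥ 2`).** Let `dim_ℂ P ≥ 2`. An additive
subgroup `W ⊆ U = P × P` which is stable under every rank-one tangent direction
`T_{|w⟩⟨v|} = offDiag (rankOne w v)` of the family of complex structures of Weil type is `⊥` or `⊤`.
Geometric reading: at ANY member `A₀` of an `(n, n)` Weil-type family, `n ≥ 2`, a real subspace
`W ⊂ H₁(A₀, ℝ)` preserved to first order by all `n²` Weil directions is `0` or everything, so no
translate of a non-zero proper abelian subvariety deforms along the whole family; this is the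
infinitesimal form of "the general member is simple", a consequence of van Geemen's Thm. 6.11
(`sMT = SU_H`) with Lemma 6.10. Proof: for `x = (x₁, x₂) ∈ W`, `x ≠ 0`: if `x₂ ≠ 0`, a `v ≠ 0`
orthogonal to `x₁` (exists as `n ≥ 2`) gives `T_{|x₂⟩⟨v|} x = (‖x₂‖² v, 0) ∈ W`; so `W` contains some
`(u, 0)`, `u ≠ 0`, and then `addSubgroup_eq_top_of_inl_mem`.
[cite: vanGeemen1994HodgeAV, Thm. 6.11 with Lemma 6.10] -/
theorem addSubgroup_eq_bot_or_eq_top_of_forall_rankOne (h2 : 2 ≤ finrank ℂ P)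
    (W : AddSubgroup (P × P)) (hW : ∀ w v : P, ∀ x ∈ W, offDiag (rankOne w v) x ∈ W) :
    W = ⊥ ∨ W = ⊤ := by
  rcases eq_or_ne W ⊥ with h | h
  · exact Or.inl h
  right
  obtain ⟨⟨⟨x₁, x₂⟩, hxW⟩, hx0⟩ := (AddSubgroup.ne_bot_iff_exists_ne_zero).1 h
  have hx0' : ((x₁, x₂) : P × P) ≠ 0 := fun h' ↦ hx0 (Subtype.ext h')
  by_cases hx₂ : x₂ = 0
  · subst hx₂
    have hx₁ : x₁ ≠ 0 := by
      rintro rfl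
      exact hx0' rfl
    exact addSubgroup_eq_top_of_inl_mem W hW hx₁ hxW
  · obtain ⟨v, hv0, hv⟩ := exists_ne_zero_inner_eq_zero h2 x₁
    have hv' : ⟪v, x₁⟫_ℂ = 0 := inner_eq_zero_symm.1 hv
    have h := hW x₂ v _ hxW
    rw [offDiag_rankOne_apply, hv', zero_smul, inner_self_eq_coe_norm_sq] at h
    refine addSubgroup_eq_top_of_inl_mem W hW (u := (((‖x₂‖ ^ 2 : ℝ) : ℂ)) • v) ?_ h
    exact smul_ne_zero (by exact_mod_cast pow_ne_zero 2 (norm_ne_zero_iff.2 hx₂)) hv0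

/-- The same with stability under the whole tangent space `𝔭 = {T_B : B ∈ End_ℂ P}`.
[cite: vanGeemen1994HodgeAV, Thm. 6.11 with Lemma 6.10] -/
theorem addSubgroup_eq_bot_or_eq_top_of_forall_offDiag (h2 : 2 ≤ finrank ℂ P)
    (W : AddSubgroup (P × P)) (hW : ∀ B : P →ₗ[ℂ] P, ∀ x ∈ W, offDiag B x ∈ W) :
    W = ⊥ ∨ W = ⊤ :=
  addSubgroup_eq_bot_or_eq_top_of_forall_rankOne h2 W fun w v ↦ hW (rankOne w v)

/-- Module version (e.g. `R = ℝ`: real subspaces of `V_ℝ = U`; `R = ℂ`, `R = ℤ`): a submodule of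
`U = P × P` stable under every `T_B ∈ 𝔭` is `⊥` or `⊤`, `n ≥ 2`.
[cite: vanGeemen1994HodgeAV, Thm. 6.11 with Lemma 6.10] -/
theorem submodule_eq_bot_or_eq_top_of_forall_offDiag {R : Type*} [Ring R] [Module R (P × P)]
    (h2 : 2 ≤ finrank ℂ P) (W : Submodule R (P × P))
    (hW : ∀ B : P →ₗ[ℂ] P, ∀ x ∈ W, offDiag B x ∈ W) : W = ⊥ ∨ W = ⊤ := by
  rcases addSubgroup_eq_bot_or_eq_top_of_forall_offDiag h2 W.toAddSubgroup
      (fun B x hx ↦ hW B x hx) with h | h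
  · left
    apply Submodule.toAddSubgroup_injective
    rw [h, Submodule.bot_toAddSubgroup]
  · right
    apply Submodule.toAddSubgroup_injective
    rw [h, Submodule.top_toAddSubgroup]

/-! ### The exception `n = 1` -/

/-- **Sharpness in `n`.** For `P = ℂ` (`n = 1`, abelian surfaces) the real plane
`W = {(z, conj z)} ⊂ ℂ × ℂ` is a non-zero proper additive subgroup stable under every rank-one
tangent direction: `T_{|w⟩⟨v|} (z, conj z) = (conj w · conj z · v, conj v · z · w)` has second entry the
conjugate of the first. Geometrically: the `(1, 1)` family `{E × E}` keeps the sub-curves `E × 0`.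
[folklore] -/
theorem exists_stable_addSubgroup_rank_one :
    ∃ W : AddSubgroup (ℂ × ℂ), W ≠ ⊥ ∧ W ≠ ⊤ ∧
      ∀ w v : ℂ, ∀ x ∈ W, offDiag (rankOne w v) x ∈ W := by
  let f : ℂ × ℂ →+ ℂ :=
    { toFun := fun x ↦ x.2 - conj x.1
      map_zero' := by simp
      map_add' := fun x y ↦ by simp [map_add]; ring }
  refine ⟨f.ker, ?_, ?_, ?_⟩
  · intro h
    have h1 : ((1, 1) : ℂ × ℂ) ∈ f.ker := by simp [f, AddMonoidHom.mem_ker]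
    rw [h, AddSubgroup.mem_bot] at h1
    exact one_ne_zero (Prod.mk.inj h1).1
  · intro h
    have h1 : ((0, 1) : ℂ × ℂ) ∈ f.ker := by rw [h]; exact AddSubgroup.mem_top _
    simp [f, AddMonoidHom.mem_ker] at h1
  · rintro w v ⟨x₁, x₂⟩ hx
    simp only [AddMonoidHom.mem_ker, AddMonoidHom.coe_mk, ZeroHom.coe_mk, sub_eq_zero, f] at hx
    subst hx
    rw [AddMonoidHom.mem_ker, offDiag_rankOne_apply]
    simp [f, map_mul]
    ring

/-! ### Scalar commutant (general member has `End ⊗ ℝ = ℂ`, infinitesimal form) -/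

/-- Block operator from two rank-one directions: for `v ⊥ v'`,
`T_{|w⟩⟨v|} (T_{|w⟩⟨v'|} x) = ‖w‖² (⟪v', x₁⟫ v, 0)`. [folklore] -/
theorem offDiag_rankOne_offDiag_rankOne_of_inner_eq_zero (w : P) {v v' : P}
    (hvv' : ⟪v, v'⟫_ℂ = 0) (x : P × P) :
    offDiag (rankOne w v) (offDiag (rankOne w v') x) =
      ((((‖w‖ ^ 2 : ℝ) : ℂ) * ⟪v', x.1⟫_ℂ) • v, 0) := by
  rw [offDiag_rankOne_apply, offDiag_rankOne_apply]
  simp only [inner_smul_right, hvv', mul_zero, zero_smul, inner_self_eq_coe_norm_sq, mul_comm]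

/-- Swapping the two blocks conjugates `T_{|w⟩⟨v|}` into `T_{|v⟩⟨w|}`. [folklore] -/
theorem offDiag_rankOne_swap (w v : P) (x : P × P) :
    (offDiag (rankOne w v) x.swap).swap = offDiag (rankOne v w) x := by
  rw [offDiag_rankOne_apply, offDiag_rankOne_apply]
  rfl

/-- Key step for the commutant: if an additive map `T` of `U` commutes with all rank-one tangent
directions, then for `v' ≠ 0` and every `v ⊥ v'`, `T (v, 0) = (c • v, 0)` with
`c = ⟪v', (T (v', 0)).1⟫ / ‖v'‖²` — obtained from `T ∘ (T_{|v'⟩⟨ṽ|} T_{|v'⟩⟨v'|}) =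
(T_{|v'⟩⟨ṽ|} T_{|v'⟩⟨v'|}) ∘ T` evaluated at `(v', 0)`, `ṽ` a rescaling of `v`. [folklore] -/
theorem apply_inl_eq_of_inner_eq_zero (T : P × P →+ P × P)
    (hT : ∀ (w v : P) (x : P × P), T (offDiag (rankOne w v) x) = offDiag (rankOne w v) (T x))
    {v' : P} (hv' : v' ≠ 0) {v : P} (hvv' : ⟪v, v'⟫_ℂ = 0) :
    T (v, 0) = ((⟪v', (T (v', 0)).1⟫_ℂ * (((‖v'‖ ^ 2)⁻¹ : ℝ) : ℂ)) • v, 0) := by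
  have hn : (‖v'‖ ^ 2 : ℝ) ≠ 0 := pow_ne_zero 2 (norm_ne_zero_iff.2 hv')
  set c₀ : ℝ := (‖v'‖ ^ 2)⁻¹ * (‖v'‖ ^ 2)⁻¹ with hc₀
  have hvv'' : ⟪(c₀ : ℂ) • v, v'⟫_ℂ = 0 := by rw [inner_smul_left, hvv', mul_zero]
  have h := congrArg T (offDiag_rankOne_offDiag_rankOne_of_inner_eq_zero v' hvv'' (v', 0))
  rw [hT, hT, offDiag_rankOne_offDiag_rankOne_of_inner_eq_zero v' hvv''] at h
  have e1 : ((((‖v'‖ ^ 2 : ℝ) : ℂ) * ⟪v', v'⟫_ℂ) • ((c₀ : ℂ) • v)) = v := by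
    rw [smul_smul, inner_self_eq_coe_norm_sq, ← Complex.ofReal_mul, ← Complex.ofReal_mul,
      show (‖v'‖ ^ 2 * ‖v'‖ ^ 2 * c₀ : ℝ) = 1 by rw [hc₀]; field_simp, Complex.ofReal_one,
      one_smul]
  have e2 : ((((‖v'‖ ^ 2 : ℝ) : ℂ) * ⟪v', (T (v', 0)).1⟫_ℂ) • ((c₀ : ℂ) • v)) =
      (⟪v', (T (v', 0)).1⟫_ℂ * (((‖v'‖ ^ 2)⁻¹ : ℝ) : ℂ)) • v := by
    rw [smul_smul]
    congr 1
    rw [mul_comm (((‖v'‖ ^ 2 : ℝ) : ℂ)), mul_assoc, ← Complex.ofReal_mul]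
    congr 2
    rw [hc₀]
    field_simp
  simp only [e1, e2] at h
  exact h.symm

/-- First block of the commutant: `T (u, 0) = (c • u, 0)` for ONE complex scalar `c` and all `u`,
when `n ≥ 2`. [folklore] -/
theorem exists_apply_inl_eq_smul (h2 : 2 ≤ finrank ℂ P) (T : P × P →+ P × P)
    (hT : ∀ (w v : P) (x : P × P), T (offDiag (rankOne w v) x) = offDiag (rankOne w v) (T x)) :
    ∃ c : ℂ, ∀ u : P, T (u, 0) = (c • u, 0) := by
  obtain ⟨v₀, hv₀, -⟩ := exists_ne_zero_inner_eq_zero h2 0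
  obtain ⟨v₁, hv₁, h01⟩ := exists_ne_zero_inner_eq_zero h2 v₀
  have h10 : ⟪v₁, v₀⟫_ℂ = 0 := inner_eq_zero_symm.1 h01
  set c : ℂ := ⟪v₀, (T (v₀, 0)).1⟫_ℂ * (((‖v₀‖ ^ 2)⁻¹ : ℝ) : ℂ) with hc
  -- vectors orthogonal to `v₀`
  have hA : ∀ v : P, ⟪v, v₀⟫_ℂ = 0 → T (v, 0) = (c • v, 0) := fun v hv ↦
    apply_inl_eq_of_inner_eq_zero T hT hv₀ hv
  -- the constant attached to `v₁` is again `c`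
  have hc₁ : ⟪v₁, (T (v₁, 0)).1⟫_ℂ * (((‖v₁‖ ^ 2)⁻¹ : ℝ) : ℂ) = c := by
    rw [hA v₁ h10]
    dsimp only
    rw [inner_smul_right, inner_self_eq_coe_norm_sq, mul_assoc, ← Complex.ofReal_mul,
      mul_inv_cancel₀ (pow_ne_zero 2 (norm_ne_zero_iff.2 hv₁)), Complex.ofReal_one, mul_one]
  -- vectors orthogonal to `v₁`, in particular the multiples of `v₀`
  have hB : ∀ v : P, ⟪v, v₁⟫_ℂ = 0 → T (v, 0) = (c • v, 0) := fun v hv ↦ by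
    rw [apply_inl_eq_of_inner_eq_zero T hT hv₁ hv, hc₁]
  refine ⟨c, fun u ↦ ?_⟩
  -- orthogonal decomposition `u = a • v₀ + u''`
  set a : ℂ := (((‖v₀‖ ^ 2)⁻¹ : ℝ) : ℂ) * ⟪v₀, u⟫_ℂ with ha
  have hu'' : ⟪u - a • v₀, v₀⟫_ℂ = 0 := by
    rw [inner_sub_left, inner_smul_left, ha, map_mul, Complex.conj_ofReal, inner_conj_symm,
      inner_self_eq_coe_norm_sq, mul_assoc, mul_comm (⟪u, v₀⟫_ℂ), ← mul_assoc,
      ← Complex.ofReal_mul, inv_mul_cancel₀ (pow_ne_zero 2 (norm_ne_zero_iff.2 hv₀)),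
      Complex.ofReal_one, one_mul, sub_self]
  have hav₀ : ⟪a • v₀, v₁⟫_ℂ = 0 := by rw [inner_smul_left, h01, mul_zero]
  have hsplit : ((u, (0 : P)) : P × P) = (a • v₀, 0) + (u - a • v₀, 0) := by simp
  rw [hsplit, map_add, hB _ hav₀, hA _ hu'', Prod.mk_add_mk, add_zero, ← smul_add,
    add_sub_cancel]

/-- **Scalar commutant along the Weil family (`n ≥ 2`).** Let `dim_ℂ P ≥ 2`. An additive map
`T : U → U`, `U = P × P`, commuting with every rank-one tangent direction
`T_{|w⟩⟨v|} = offDiag (rankOne w v)` is multiplication by a complex scalar. Geometric reading: at ANY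
member `A₀` of an `(n, n)` Weil-type family, `n ≥ 2`, an endomorphism of `H₁(A₀, ℝ)` which stays of
type `(0,0)` to first order in all `n²` Weil directions lies in `K ⊗ ℝ = ℂ`; the infinitesimal form
of `End⁰ = K` for the general member (van Geemen Thm. 6.11 with Lemma 6.10 and Schur's lemma).
Proof: `exists_apply_inl_eq_smul` on `T` and on its block-swap conjugate gives `T (u, 0) = (c u, 0)`,
`T (0, u) = (0, c' u)`; comparing `T (T_{|v₀⟩⟨v₀|} (v₀, 0))` both ways gives `c = c'`.
[cite: vanGeemen1994HodgeAV, Thm. 6.11 with Lemma 6.10] -/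
theorem exists_eq_smul_of_forall_rankOne (h2 : 2 ≤ finrank ℂ P) (T : P × P →+ P × P)
    (hT : ∀ (w v : P) (x : P × P), T (offDiag (rankOne w v) x) = offDiag (rankOne w v) (T x)) :
    ∃ c : ℂ, ∀ x : P × P, T x = c • x := by
  obtain ⟨c, hc⟩ := exists_apply_inl_eq_smul h2 T hT
  -- the block-swap conjugate of `T`
  let S : P × P ≃+ P × P := AddEquiv.prodComm
  let T' : P × P →+ P × P := S.toAddMonoidHom.comp (T.comp S.toAddMonoidHom)
  have hT'apply : ∀ x : P × P, T' x = (T x.swap).swap := fun x ↦ rfl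
  have hT' : ∀ (w v : P) (x : P × P),
      T' (offDiag (rankOne w v) x) = offDiag (rankOne w v) (T' x) := by
    intro w v x
    rw [hT'apply, hT'apply, ← offDiag_rankOne_swap v w x, Prod.swap_swap, hT,
      ← offDiag_rankOne_swap w v, Prod.swap_swap]
  obtain ⟨c', hc'⟩ := exists_apply_inl_eq_smul h2 T' hT'
  have hinr : ∀ u : P, T (0, u) = (0, c' • u) := by
    intro u
    have h := hc' u
    rw [hT'apply, Prod.swap_prod_mk] at h
    simpa using congrArg Prod.swap h
  -- `c = c'`
  obtain ⟨v₀, hv₀, -⟩ := exists_ne_zero_inner_eq_zero h2 0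
  have hcc' : c' = c := by
    have h := hT v₀ v₀ (v₀, 0)
    rw [offDiag_rankOne_inl, hinr, hc, offDiag_rankOne_inl, inner_smul_right] at h
    have h' := (Prod.mk.inj h).2
    rw [← smul_smul] at h'
    have hne : ⟪v₀, v₀⟫_ℂ • v₀ ≠ 0 := smul_ne_zero
      (by rw [inner_self_eq_coe_norm_sq]; exact_mod_cast pow_ne_zero 2 (norm_ne_zero_iff.2 hv₀))
      hv₀
    exact smul_left_injective ℂ hne h'
  refine ⟨c, fun x ↦ ?_⟩
  obtain ⟨x₁, x₂⟩ := x
  have hx : ((x₁, x₂) : P × P) = (x₁, 0) + (0, x₂) := by simp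
  rw [hx, map_add, hc, hinr, hcc']
  simp

/-- The same with `T` commuting with the whole tangent space `𝔭 = {T_B : B ∈ End_ℂ P}`.
[cite: vanGeemen1994HodgeAV, Thm. 6.11 with Lemma 6.10] -/
theorem exists_eq_smul_of_forall_offDiag (h2 : 2 ≤ finrank ℂ P) (T : P × P →+ P × P)
    (hT : ∀ (B : P →ₗ[ℂ] P) (x : P × P), T (offDiag B x) = offDiag B (T x)) :
    ∃ c : ℂ, ∀ x : P × P, T x = c • x :=
  exists_eq_smul_of_forall_rankOne h2 T fun w v ↦ hT (rankOne w v)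

end WeilFamily

end Summit.Ventures.HSemireg
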